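import Literature.MathematicalPhysics.QuantumFieldTheory.BalabanImbrieJaffe1984to88.BIJ88SlotFieldGaussBounds
import Literature.MathematicalPhysics.QuantumFieldTheory.BalabanImbrieJaffe1984to88.BIJ88CutoffProfileWitness
import Literature.MathematicalPhysics.QuantumFieldTheory.BalabanImbrieJaffe1984to88.BIJ88SmallChargeRegime

/-!
# `BalabanImbrieJaffe1984to88.BIJ88Ineq307UnitModel` — T. Bałaban, J. Imbrie, A. Jaffe, *Effective action and cluster properties of the abelian
Higgs model*, Commun. Math. Phys. **114** (1988) 257–315 [BalabanImbrieJaffe1988], Sect. 5.13, p. 307 [PDF 51]: **THE ONE-CUBE SENTENCE OF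
THE DECOUPLING ESTIMATE — r16's typed leaf `BIJ88Sect5StatementsPart2.Ineq307unit` INHABITED IN THE §5.13 GAUSSIAN MODEL.**

statement-level skeleton of published theorems with citation tags; proofs where landed; nothing here is a claim about the Yang–Mills mass gap

p. 307, verbatim (text layer `paper:balaban1988-cmp114-bij-abelian-higgs-effective-action` p0051 L30–32, journal page = PDF page + 256, read this
generation): *"If |X_α| = 1, with no F^{m̄}_{k,loc}-factors, then we have the more precise bound |g₂(X_α) − 1| ≤ e^β(L^kε/ε₀)^{1/4−α}, obtained
from the same estimates on the S_γ, S₅ sums, and from extremely small factors when a χ′-factor is replaced by 1."*  r16 typed it (p240155) as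
`Ineq307unit P g₂ noF θ := ∀ X, P.card X = 1 → noF X → |g₂ X − 1| ≤ θ` over an abstract polymer system.

WHAT IS PROVED (unit `lit-balaban-p36`, generation 16 of the Phase-2 proof seat p36; SKELETON row **C2.Claim@307** member cell of
`HOME/lit-balaban-r16/ROWS-C2-part2.md`, owner r16, whose v2.204 xref already points the sentence to p36 gen 15's
`BIJ88OneCubeVertexFactors309.abs_integral_prod_slotFactor_sub_one_le_rpow`; this file lands the sentence BY THE LEAF'S NAME).  The polymer
system is p25's `BIJ88Ineq5113Covering.cubeSys I` (polymers = finite cube sets, `|X|` = number of cubes); the activities are those of the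
§5.13 expansion (5.13.6) in the finite-dimensional Gaussian model of this lineage (p27 `polymerRep_gauss`): `g₂ = g1 adj (zG blk Δ ℱ f_t)` for
the slot-product observables `f_t(□_i) = Π_{τ ⊂ □_i} (slot factor of τ at time t)` = `fD (uD χ p e_k B Φ c Ys V t) cube γ ∅` (χ-slots
`χ(c_b p(te_k), Φ_b)`, interaction slots `e^{−tV(Y)}`; at `t = 1` print's `χ′ e^{−Ṽ}`), for ANY predicate `noF` (the model's `g₂` carries no
`F^{m̄}_{k,loc}`-factors at all: the observables enter only through the differentiation (5.14.5), downstream).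
§1 `g1_zG_singleton_eq`: on a one-cube polymer the activity IS the one-cube expectation `∫ Π_{τ ⊂ □_i}(slot factors) d law(□_i)` (p27's
`g1_singleton` + p36 g10's `expect_corner_eq_integral`).  §2 **`ineq307unit_of_tail`**: `Ineq307unit (cubeSys I) g₂ noF θ` under the one-cube
regime of p36 gen 15 (`Δ ≻ 0` of ANY coupling, `χ ≥ 0`, thresholds `c_b ≥ c₀ > 0`, measurable slot fields with one-cube sub-Gaussian tails
`law(□_i){a ≤ |Φ_b|} ≤ A e^{−κa²}`, measurable terms `|V(Y)| ≤ K_Y ≤ K₁`, `≤ G` slots per cube, `0 < e_k ≤ e⁻¹`, `t ∈ (0,1]`, and the two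
`e_k`-smallness inequalities `1 ≤ κ(81/100)c₀²|log e_k⁻¹|^{2p−1}`, `e^{GK₁}·G·A·e_k + (e^{GK₁} − 1) ≤ θ`) — proof: §1 and gen 15's
`abs_integral_prod_slotFactor_sub_one_le_rpow` at `β′ = 1`.  §3 **`ineq307unit_of_struct`**: the same with the law-level tail input REPLACED by
structural data (`Δ ≥ m·1` as a form, slot fields linear `ℓ₁` or modulus `√(ℓ₁² + ℓ₂²)` with `|ℓ_j φ| ≤ Λ‖φ‖₂`, `‖ℱ|_□‖₂ ≤ F`; tail constants
`A = 4e^{F²/(2m)}`, `κ = m/(8Λ²)` from p36 g16's `BIJ88SlotFieldGaussBounds.tail_slotField_fieldLaw_of_struct`; p. 307 *"here we use the fact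
that the translation vanishes"* is `F = 0`).  §4 **`ineq307unit_instance_uniform`** — KERNEL CERTIFICATE WITH A UNIFORM THRESHOLD: for `p > 1/2`
there is `e₀(p) > 0` such that for EVERY finite cube set `I`, every abutting relation, every cube map of the form `Sum.inl b ↦ b`, every
`e_k ∈ (0, e₀)`, `t ∈ (0,1]`, assignment and predicate, the data «sites = cubes, `Δ = 1`, `ℱ = 0`, one linear χ-slot per cube (the site field),
`c ≡ 1`, no interaction terms, `χ = gevreyCutoff`» satisfy `Ineq307unit (cubeSys I) g₂ noF √e_k` — every hypothesis of §3 discharged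
(`m = Λ = 1`, `F = 0`, `G = 1`, `K₁ = 0`), the threshold chosen BEFORE the datum.
HONEST SCOPE: MODEL-LEVEL, exactly as r16 labels the v2.204 xref — print's `θ = e^β(L^kε/ε₀)^{1/4−α}` and the sizes of the `S_γ`, `S₅` sums are the
hypotheses' letters (`θ`, `A`, `κ`, `K_Y`, `G`), not derived from Sects. 2–4; the multi-cube decoupling estimate `Ineq307` (the display with
`(e^β(L^kε/ε₀)^{1/4−α})^{β′}`, the inductive cluster-expansion decay) is NOT treated and the head of row C2.Claim@307 stays typed.  0 `sorry`,
0 definitions, 0 `Prop` facts (D-0026); imports `BIJ88SlotFieldGaussBounds` (p36 g16), `BIJ88CutoffProfileWitness` (p36), `BIJ88SmallChargeRegime`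
(p36 g6); modifies nothing.  NOT summit progress; NOT continuum; NOT Clay.  Cell `lit-balaban` Phase 2, seat p36 gen 16 (owner r16, referee ref-5).
-/

noncomputable section

open Finset MeasureTheory Matrix ProbabilityTheory Filter
open Literature.MathematicalPhysics.QuantumFieldTheory.BalabanImbrieJaffe1984to88
open BIJ88Sect2Statements (pLog)
open BIJ88Sect5Statements (CutoffProfile cutoff)
open BIJ88Sect5StatementsPart2 (Ineq307unit)
open BIJ88Ineq5113Covering (cubeSys cubeSys_card)
open BIJ88SlotMoments308 (slotFactor)
open BIJ88PolymerRep5134 (g1 g1_singleton corner)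
open BIJ88PolymerRep5134Gauss (ext obs prec src expect zG)
open BIJ88Expansion5143Gauss (fD)
open BIJ88SlotMomentsGauss308 (uD fieldLaw isProbabilityMeasure_fieldLaw measurable_ext expect_corner_eq_integral slotFactor_ext)
open BIJ88Eq5145CornerModel (prec_corner_posDef)
open BIJ88OneCubeVertexFactors309 (abs_integral_prod_slotFactor_sub_one_le_rpow)
open BIJ88SlotFieldGaussBounds (tail_slotField_fieldLaw_of_struct tail_constants_eq)
open BIJ88CutoffProfileWitness (gevreyCutoff chi1_nonneg)
open BIJ88SmallChargeRegime (exists_threshold eventually_const_le_mul_log_rpow eventually_const_mul_le_one)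

namespace Literature.MathematicalPhysics.QuantumFieldTheory.BalabanImbrieJaffe1984to88.BIJ88Ineq307UnitModel

section Model

variable {α I : Type} [Fintype α] [DecidableEq α] [Fintype I] [DecidableEq I]
  (blk : α → I) (Δ : Matrix α α ℝ) (ℱ : α → ℝ)
variable (adj : I → I → Prop) [DecidableRel adj]
variable (χ : CutoffProfile) {ι υ : Type*} [DecidableEq ι] [DecidableEq υ]
variable {p ek : ℝ} {B : Finset ι} {Φ : ι → (α → ℝ) → ℝ} {c : ι → ℝ} {Ys : Finset υ} {V : υ → (α → ℝ) → ℝ}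
variable (cube : ↥B ⊕ ↥Ys → I)

/-! ## §1 The activity of a one-cube polymer is the one-cube expectation of the slot product -/

variable (p ek B Φ c Ys V) in
/-- **`g₂(□_i) = ∫ Π_{τ ⊂ □_i} (slot factor of τ at time t) d law(□_i)`** (p. 306 (5.13.5): a one-cube polymer is a single cluster only for
`Γ = ∅`, so `g₁(□_i) = ⟨f(□_i)⟩_{□_i}` — p27's `g1_singleton`; the un-interpolated one-cube expectation is the integral against the law of the
fields of `□_i` — p36 g10's `expect_corner_eq_integral`; no derivative acts (`H = ∅`), so the observable of `□_i` is the plain product of its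
slot factors). [cite: BalabanImbrieJaffe1988, (5.13.5)–(5.13.6) p.306; (5.14.3) p.309] -/
theorem g1_zG_singleton_eq (t : ℝ) {L : Type*} (γ : L → ↥B ⊕ ↥Ys) (i : I) :
    g1 adj (zG blk Δ ℱ (fD (uD χ p ek B Φ c Ys V t) cube γ ∅)) {i} =
      ∫ ω, ∏ τ ∈ univ.filter (fun τ => cube τ = i),
        slotFactor χ p ek B (fun b ω => Φ b (ext blk {i} ω)) c Ys (fun Y ω => V Y (ext blk {i} ω)) ω τ t ∂(fieldLaw blk Δ ℱ {i}) := by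
  rw [g1_singleton, BIJ88PolymerRep5134Gauss.zG, expect_corner_eq_integral]
  refine integral_congr_ae (Eventually.of_forall fun ω => ?_)
  simp only [BIJ88PolymerRep5134Gauss.obs, prod_singleton, fD, filter_empty, card_empty, uD, iteratedDeriv_zero, slotFactor_ext]

/-! ## §2 `Ineq307unit` in the model under the one-cube regime (law-level tails) -/

/-- **p. 307, THE ONE-CUBE SENTENCE, IN THE §5.13 MODEL** (verbatim: *"If |X_α| = 1, with no F^{m̄}_{k,loc}-factors, then we have the more precise
bound |g₂(X_α) − 1| ≤ e^β(L^kε/ε₀)^{1/4−α}, obtained from the same estimates on the S_γ, S₅ sums, and from extremely small factors when a χ′-factor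
is replaced by 1."*): for the §5.13 data with `Δ ≻ 0` (any coupling — a single cube carries no interpolation), `χ ≥ 0`, thresholds
`c_b ≥ c₀ > 0`, measurable slot fields whose ONE-CUBE LAWS have the sub-Gaussian tail `law(□_i){a ≤ |Φ_b|} ≤ A e^{−κa²}` (`a ≥ 0`), measurable
terms `|V(Y)| ≤ K_Y ≤ K₁`, at most `G` slots per cube, `0 < e_k ≤ e⁻¹`, `t ∈ (0,1]`, in the `e_k`-small regime `1 ≤ κ(81/100)c₀²|log e_k⁻¹|^{2p−1}`,
`e^{GK₁}·G·A·e_k + (e^{GK₁} − 1) ≤ θ`: r16's typed leaf holds for the (5.13.6) activities of the slot-product observables at time `t`, on p25's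
polymer system of cube sets, for EVERY predicate `noF` — `Ineq307unit (cubeSys I) g₂ noF θ`, i.e. `|g₂(X) − 1| ≤ θ` whenever `|X| = 1`.  Proof:
§1 and p36 gen 15's `BIJ88OneCubeVertexFactors309.abs_integral_prod_slotFactor_sub_one_le_rpow` (`β′ = 1`).  MODEL-LEVEL: print's
`θ = e^β(L^kε/ε₀)^{1/4−α}` and the `S_γ`, `S₅` estimates are the hypotheses' letters. [cite: BalabanImbrieJaffe1988, p.307 (Sect. 5.13)] -/
theorem ineq307unit_of_tail (hp : 1 / 2 < p) (hΔ : Δ.PosDef) (hχ : ∀ x, 0 ≤ χ.χ₁ x) {c₀ : ℝ} (hc₀ : 0 < c₀) (hcb : ∀ b ∈ B, c₀ ≤ c b)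
    (hΦm : ∀ b ∈ B, Measurable (Φ b)) (hV : ∀ Y ∈ Ys, Measurable (V Y)) {KY : υ → ℝ} (hK : ∀ Y ∈ Ys, ∀ φ, |V Y φ| ≤ KY Y)
    {K₁ : ℝ} (hK₁0 : 0 ≤ K₁) (hK₁ : ∀ Y ∈ Ys, KY Y ≤ K₁) {G : ℕ} (hG : ∀ i, (univ.filter fun τ : ↥B ⊕ ↥Ys => cube τ = i).card ≤ G)
    {A κ : ℝ} (hA : 0 ≤ A) (hκ : 0 ≤ κ)
    (htail : ∀ (i : I) (b : ↥B), cube (Sum.inl b) = i → ∀ a : ℝ, 0 ≤ a →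
      (fieldLaw blk Δ ℱ {i}).real {ω | a ≤ |Φ b (ext blk {i} ω)|} ≤ A * Real.exp (-(κ * a ^ 2)))
    (hek : 0 < ek) (hek1 : ek ≤ Real.exp (-1)) {θ : ℝ}
    (hreg : (1 : ℝ) ≤ κ * (81 / 100) * c₀ ^ 2 * Real.log ek⁻¹ ^ (2 * p - 1))
    (hvac : Real.exp (G * K₁) * G * A * ek + (Real.exp (G * K₁) - 1) ≤ θ)
    {t : ℝ} (ht : t ∈ Set.Ioc (0 : ℝ) 1) {L : Type*} (γ : L → ↥B ⊕ ↥Ys) (noF : Finset I → Prop) :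
    Ineq307unit (cubeSys I) (g1 adj (zG blk Δ ℱ (fD (uD χ p ek B Φ c Ys V t) cube γ ∅))) noF θ := by
  intro X hX _
  rw [cubeSys_card] at hX
  obtain ⟨i, rfl⟩ := card_eq_one.1 hX
  rw [g1_zG_singleton_eq]
  -- the one-cube probability space and the slot family of `□_i`
  haveI : IsProbabilityMeasure (fieldLaw blk Δ ℱ {i}) := isProbabilityMeasure_fieldLaw blk Δ ℱ {i} (prec_corner_posDef blk Δ hΔ {i} {i})
  set T : Finset (↥B ⊕ ↥Ys) := univ.filter (fun τ => cube τ = i) with hT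
  have hTl : ∀ b ∈ T.toLeft, cube (Sum.inl b) = i := fun b hb => (mem_filter.1 (Finset.mem_toLeft.1 hb)).2
  have hcb' : ∀ b ∈ T.toLeft, c₀ ≤ c b := fun b _ => hcb b b.2
  have hK' : ∀ Y ∈ T.toRight, ∀ ω : {x : α // blk x ∈ ({i} : Finset I)} → ℝ,
      |(fun (Y : υ) ω => V Y (ext blk {i} ω)) Y ω| ≤ KY Y := fun Y _ ω => hK Y Y.2 _
  have hΦ' : ∀ b ∈ T.toLeft, Measurable fun ω : {x : α // blk x ∈ ({i} : Finset I)} → ℝ =>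
      (fun (b : ι) ω => Φ b (ext blk {i} ω)) b ω := fun b _ => (hΦm b b.2).comp (measurable_ext blk {i})
  have hV' : ∀ Y ∈ T.toRight, Measurable fun ω : {x : α // blk x ∈ ({i} : Finset I)} → ℝ =>
      (fun (Y : υ) ω => V Y (ext blk {i} ω)) Y ω := fun Y _ => (hV Y Y.2).comp (measurable_ext blk {i})
  have htail' : ∀ b ∈ T.toLeft, ∀ a : ℝ, 0 ≤ a →
      (fieldLaw blk Δ ℱ {i}).real {ω | a ≤ |(fun (b : ι) ω => Φ b (ext blk {i} ω)) b ω|} ≤ A * Real.exp (-(κ * a ^ 2)) :=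
    fun b hb a ha => htail i b (hTl b hb) a ha
  -- slots per cube: `|T| ≤ G`, hence the interaction weight `Σ_Y K_Y ≤ G K₁` and `≤ G` χ-slots
  have hTG : T.card ≤ G := hG i
  have hKsum : ∑ Y ∈ T.toRight, KY Y ≤ G * K₁ := by
    refine (sum_le_card_nsmul T.toRight (fun Y : ↥Ys => KY Y) K₁ fun Y _ => hK₁ Y Y.2).trans ?_
    rw [nsmul_eq_mul]
    have h : ((T.toRight).card : ℝ) ≤ G := by exact_mod_cast (Finset.card_toRight_le).trans hTG
    exact mul_le_mul_of_nonneg_right h hK₁0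
  have hGl : ((T.toLeft).card : ℝ) ≤ G := by exact_mod_cast (Finset.card_toLeft_le).trans hTG
  have hvac' : Real.exp (G * K₁) * G * A * ek + (Real.exp (G * K₁) - 1) ≤ θ ^ (1 : ℝ) := by rwa [Real.rpow_one]
  have h := abs_integral_prod_slotFactor_sub_one_le_rpow χ (fieldLaw blk Δ ℱ {i}) p ek B (fun b ω => Φ b (ext blk {i} ω)) c Ys
    (fun Y ω => V Y (ext blk {i} ω)) hχ hp hek hek1 ht.1 ht.2 T hc₀ hcb' KY hK' hKsum hΦ' hV' hA hκ htail' hGl hreg hvac'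
  rwa [Real.rpow_one] at h

/-! ## §3 The same with the tail input replaced by structural data -/

/-- **p. 307, THE ONE-CUBE SENTENCE, IN THE §5.13 MODEL — TAILS FROM STRUCTURAL DATA** (p. 307: *"These derivatives are supported at
|A^{(k)″}| ≧ cp(e_k) or |φ^{(k)″}| ≧ cp(e_k) (here we use the fact that the translation vanishes)"*; p. 308: the χ-slot fields are
`(I − Q_s*Q)A^{(k)}` — linear — and `φ^{(k)}` — a modulus): §2 with `hΦm`, `hA`, `hκ`, `htail` REPLACED by `Δ ≥ m·1` as a form (`m > 0`), every
χ-slot field a linear functional `ℓ₁` or a modulus `√(ℓ₁² + ℓ₂²)` with `|ℓ_j φ| ≤ Λ‖φ‖₂` (`Λ > 0`), and `‖ℱ|_□‖₂ ≤ F` on every cube (`F = 0` when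
the translation vanishes); the tail constants become `A = 4e^{F²/(2m)}`, `κ = m/(8Λ²)` (p36 g16's
`BIJ88SlotFieldGaussBounds.tail_slotField_fieldLaw_of_struct`).  Conclusion: `Ineq307unit (cubeSys I) g₂ noF θ`.
[cite: BalabanImbrieJaffe1988, p.307 (Sect. 5.13); (5.14.2) p.308] -/
theorem ineq307unit_of_struct (hp : 1 / 2 < p) (hΔ : Δ.PosDef) {m : ℝ} (hm : 0 < m) (hΔm : ∀ φ : α → ℝ, m * (φ ⬝ᵥ φ) ≤ φ ⬝ᵥ (Δ *ᵥ φ))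
    (hχ : ∀ x, 0 ≤ χ.χ₁ x) {c₀ : ℝ} (hc₀ : 0 < c₀) (hcb : ∀ b ∈ B, c₀ ≤ c b) {Λ : ℝ} (hΛ : 0 < Λ)
    (hmod : ∀ b ∈ B, ∃ ℓ₁ ℓ₂ : (α → ℝ) → ℝ, IsLinearMap ℝ ℓ₁ ∧ IsLinearMap ℝ ℓ₂ ∧
      ((∀ φ, Φ b φ = ℓ₁ φ) ∨ (∀ φ, Φ b φ = Real.sqrt (ℓ₁ φ ^ 2 + ℓ₂ φ ^ 2))) ∧
      (∀ φ, |ℓ₁ φ| ≤ Λ * Real.sqrt (φ ⬝ᵥ φ)) ∧ (∀ φ, |ℓ₂ φ| ≤ Λ * Real.sqrt (φ ⬝ᵥ φ)))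
    {F : ℝ} (hF0 : 0 ≤ F) (hF : ∀ i : I, src blk ℱ {i} ⬝ᵥ src blk ℱ {i} ≤ F ^ 2)
    (hV : ∀ Y ∈ Ys, Measurable (V Y)) {KY : υ → ℝ} (hK : ∀ Y ∈ Ys, ∀ φ, |V Y φ| ≤ KY Y)
    {K₁ : ℝ} (hK₁0 : 0 ≤ K₁) (hK₁ : ∀ Y ∈ Ys, KY Y ≤ K₁) {G : ℕ} (hG : ∀ i, (univ.filter fun τ : ↥B ⊕ ↥Ys => cube τ = i).card ≤ G)
    (hek : 0 < ek) (hek1 : ek ≤ Real.exp (-1)) {θ : ℝ}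
    (hreg : (1 : ℝ) ≤ m / (8 * Λ ^ 2) * (81 / 100) * c₀ ^ 2 * Real.log ek⁻¹ ^ (2 * p - 1))
    (hvac : Real.exp (G * K₁) * G * (4 * Real.exp (F ^ 2 / (2 * m))) * ek + (Real.exp (G * K₁) - 1) ≤ θ)
    {t : ℝ} (ht : t ∈ Set.Ioc (0 : ℝ) 1) {L : Type*} (γ : L → ↥B ⊕ ↥Ys) (noF : Finset I → Prop) :
    Ineq307unit (cubeSys I) (g1 adj (zG blk Δ ℱ (fD (uD χ p ek B Φ c Ys V t) cube γ ∅))) noF θ := by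
  obtain ⟨hc1, hc2⟩ := tail_constants_eq hm hΛ F
  have hΦm : ∀ b ∈ B, Measurable (Φ b) := fun b hb => by
    obtain ⟨ℓ₁, ℓ₂, h₁, h₂, h, -, -⟩ := hmod b hb
    exact (BIJ88GaussShellModulus309.continuous_and_zero_of_mod h₁ h₂ h).1.measurable
  have htail : ∀ (i : I) (b : ↥B), cube (Sum.inl b) = i → ∀ a : ℝ, 0 ≤ a →
      (fieldLaw blk Δ ℱ {i}).real {ω | a ≤ |Φ b (ext blk {i} ω)|} ≤ 4 * Real.exp (F ^ 2 / (2 * m)) * Real.exp (-(m / (8 * Λ ^ 2) * a ^ 2)) := by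
    intro i b _ a ha
    obtain ⟨ℓ₁, ℓ₂, h₁, h₂, h, hΛ₁, hΛ₂⟩ := hmod b b.2
    rw [← hc1, ← hc2]
    exact tail_slotField_fieldLaw_of_struct blk Δ ℱ {i} hΔ hm hΔm h₁ h₂ h hΛ hΛ₁ hΛ₂ hF0 (hF i) ha
  exact ineq307unit_of_tail blk Δ ℱ adj χ cube hp hΔ hχ hc₀ hcb hΦm hV hK hK₁0 hK₁ hG (by positivity) (by positivity) htail hek hek1 hreg
    hvac ht γ noF

end Model

/-! ## §4 A kernel certificate with a uniform threshold `e₀(p)` -/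

/-- **KERNEL CERTIFICATE OF §3 WITH A THRESHOLD CHOSEN BEFORE THE DATUM**: for `p > 1/2` there is `e₀ > 0` such that for every finite cube set
`I`, every abutting relation, every cube map of the form `Sum.inl b ↦ b`, every `e_k ∈ (0, e₀)`, every `t ∈ (0,1]`, assignment `γ` and predicate
`noF`, the data «sites = cubes, `Δ = 1`, `ℱ = 0`, one linear χ-slot per cube (the site field), `c ≡ 1`, no interaction terms, `χ = gevreyCutoff`»
satisfy r16's typed leaf with `θ = √e_k`: `Ineq307unit (cubeSys I) g₂ noF √e_k` — every hypothesis of `ineq307unit_of_struct` discharged with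
the ABSOLUTE constants `m = Λ = 1`, `F = 0` (`A = 4`, `κ = 1/8`), `G = 1`, `K₁ = 0`, `c₀ = 1`. [cite: BalabanImbrieJaffe1988, p.307 (Sect. 5.13)] -/
theorem ineq307unit_instance_uniform {p : ℝ} (hp : 1 / 2 < p) :
    ∃ e₀ : ℝ, 0 < e₀ ∧ ∀ {I : Type} [Fintype I] [DecidableEq I] (adj : I → I → Prop) [DecidableRel adj]
      {cube : ↥(univ : Finset I) ⊕ ↥(∅ : Finset I) → I} (_ : ∀ b, cube (Sum.inl b) = b.1) ⦃e : ℝ⦄, 0 < e → e < e₀ →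
      ∀ {t : ℝ} (_ : t ∈ Set.Ioc (0 : ℝ) 1) {L : Type} (γ : L → ↥(univ : Finset I) ⊕ ↥(∅ : Finset I)) (noF : Finset I → Prop),
        Ineq307unit (cubeSys I)
          (g1 adj (zG (id : I → I) (1 : Matrix I I ℝ) (0 : I → ℝ)
            (fD (uD gevreyCutoff p e (univ : Finset I) (fun (i : I) (φ : I → ℝ) => φ i) (fun _ => (1 : ℝ)) (∅ : Finset I)
              (fun (_ : I) (_ : I → ℝ) => (0 : ℝ)) t) cube γ ∅)))
          noF (Real.sqrt e) := by
  classical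
  have hκ0 : 0 < 1 / (8 * (1 : ℝ) ^ 2) * (81 / 100) * (1 : ℝ) ^ 2 := by positivity
  -- the `e_k`-small regime: the three conditions eventually, the threshold BEFORE the datum
  obtain ⟨δ, hδ, hreg⟩ := exists_threshold (Q := fun x : ℝ =>
      ((1 : ℝ) ≤ 1 / (8 * (1 : ℝ) ^ 2) * (81 / 100) * (1 : ℝ) ^ 2 * Real.log x⁻¹ ^ (2 * p - 1)) ∧ Real.exp 1 * x ≤ 1 ∧ 16 * x ≤ 1) (by
    filter_upwards [eventually_const_le_mul_log_rpow 1 _ (2 * p - 1) hκ0 (by linarith), eventually_const_mul_le_one (Real.exp 1),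
      eventually_const_mul_le_one 16] with x h1 h2 h3
    exact ⟨h1, h2, h3⟩)
  refine ⟨δ, hδ, ?_⟩
  intro I _ _ adj _ cube hcube e he heδ t ht L γ noF
  obtain ⟨h1, h2, h3⟩ := hreg e he heδ
  -- elementary consequences of the regime
  have he1 : e ≤ Real.exp (-1) := by
    have hpos := Real.exp_pos 1
    calc e = Real.exp 1 * e / Real.exp 1 := by field_simp
      _ ≤ 1 / Real.exp 1 := by gcongr
      _ = Real.exp (-1) := by rw [Real.exp_neg, one_div]
  have hsq4 : Real.sqrt e ≤ 1 / 4 := by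
    have h16 : e ≤ (1 / 4) ^ 2 := by nlinarith
    calc Real.sqrt e ≤ Real.sqrt ((1 / 4) ^ 2) := Real.sqrt_le_sqrt h16
      _ = 1 / 4 := Real.sqrt_sq (by norm_num)
  -- the structural data: `Δ = 1 ≥ 1·1`, slot fields = coordinates (`Λ = 1`), `ℱ = 0` (`F = 0`), one slot per cube
  have hΔm : ∀ φ : I → ℝ, 1 * (φ ⬝ᵥ φ) ≤ φ ⬝ᵥ ((1 : Matrix I I ℝ) *ᵥ φ) := fun φ => by rw [Matrix.one_mulVec, one_mul]
  have hlin : ∀ i : I, IsLinearMap ℝ (fun φ : I → ℝ => φ i) := fun i => (LinearMap.proj (R := ℝ) (φ := fun _ : I => ℝ) i).isLinear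
  have hΛ : ∀ (i : I) (φ : I → ℝ), |φ i| ≤ 1 * Real.sqrt (φ ⬝ᵥ φ) := fun i φ => by
    rw [one_mul]
    refine Real.abs_le_sqrt ?_
    rw [pow_two]
    exact Finset.single_le_sum (f := fun j => φ j * φ j) (fun j _ => mul_self_nonneg (φ j)) (mem_univ i)
  have hF : ∀ i : I, src (id : I → I) (0 : I → ℝ) {i} ⬝ᵥ src (id : I → I) (0 : I → ℝ) {i} ≤ (0 : ℝ) ^ 2 := fun i => by
    simp [BIJ88PolymerRep5134Gauss.src, dotProduct]
  have hG : ∀ i : I, (univ.filter fun τ : ↥(univ : Finset I) ⊕ ↥(∅ : Finset I) => cube τ = i).card ≤ 1 := fun i =>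
    card_le_one.2 fun a ha b hb => by
      obtain ⟨-, ha⟩ := mem_filter.1 ha
      obtain ⟨-, hb⟩ := mem_filter.1 hb
      rcases a with a | a
      · rcases b with b | b
        · rw [hcube] at ha hb
          rw [Subtype.ext (ha.trans hb.symm)]
        · exact absurd b.2 (notMem_empty _)
      · exact absurd a.2 (notMem_empty _)
  -- the regime inequalities in the shape of §3 (`G = 1`, `K₁ = 0`, `m = Λ = 1`, `F = 0`, `θ = √e_k`)
  have hvac : Real.exp (((1 : ℕ) : ℝ) * 0) * ((1 : ℕ) : ℝ) * (4 * Real.exp ((0 : ℝ) ^ 2 / (2 * 1))) * e + (Real.exp (((1 : ℕ) : ℝ) * 0) - 1) ≤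
      Real.sqrt e := by
    have : Real.exp (((1 : ℕ) : ℝ) * 0) * ((1 : ℕ) : ℝ) * (4 * Real.exp ((0 : ℝ) ^ 2 / (2 * 1))) * e + (Real.exp (((1 : ℕ) : ℝ) * 0) - 1) =
        4 * e := by simp
    rw [this]
    calc 4 * e = (4 * Real.sqrt e) * Real.sqrt e := by rw [mul_assoc, Real.mul_self_sqrt he.le]
      _ ≤ 1 * Real.sqrt e := by gcongr; linarith
      _ = Real.sqrt e := one_mul _
  have hreg' : (1 : ℝ) ≤ 1 / (8 * (1 : ℝ) ^ 2) * (81 / 100) * (1 : ℝ) ^ 2 * Real.log e⁻¹ ^ (2 * p - 1) := h1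
  exact ineq307unit_of_struct (id : I → I) (1 : Matrix I I ℝ) (0 : I → ℝ) adj gevreyCutoff cube hp Matrix.PosDef.one (m := 1) one_pos hΔm
    chi1_nonneg (c₀ := 1) one_pos (fun _ _ => le_rfl) (Λ := 1) one_pos
    (fun b _ => ⟨fun φ => φ b, fun φ => φ b, hlin b, hlin b, Or.inl fun _ => rfl, hΛ b, hΛ b⟩) (F := 0) le_rfl hF
    (fun Y hY => absurd hY (notMem_empty Y)) (KY := fun _ => 0) (fun Y hY => absurd hY (notMem_empty Y)) (K₁ := 0) le_rfl
    (fun Y hY => absurd hY (notMem_empty Y)) (G := 1) hG he he1 (θ := Real.sqrt e) hreg' hvac ht γ noF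

end Literature.MathematicalPhysics.QuantumFieldTheory.BalabanImbrieJaffe1984to88.BIJ88Ineq307UnitModel

end
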